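import Mathlib
import HarnessLib
import Summits.AtomisticToContinuum.Crystallization.Theorems.PricedLinkCensusSoftFourRingsNoSlack

/-!
# Soft four-rings, endgame groundwork: the facets once there is no slack

Support file for `SoftFourRings` (route `PricedLinkCensus`, sub-problem `Crystallization`),
endgame groundwork (evidence file §12.8).  In the hull-level setting of the twelve-point
reduction (conditional on Tammes-13), after `no_slack_one_percent` every facet is

* a triangle with at most one side outside `B` (a bond triangle or a "BBD" triangle), or
* a quadrilateral all of whose sides lie in `B`

(`facet_kinds_of_no_slack`), and exactly two bond triangles pass through every vertex.
-/

namespace Summit.AtomisticToContinuum.Crystallization.Theorems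

open Real RealInnerProductSpace Literature.Geometry.DiscreteGeometry

section Setting

variable {X : Finset (EuclideanSpace ℝ (Fin 3))} {B : Finset (Finset (EuclideanSpace ℝ (Fin 3)))}
  (hT : musinTarasov2012_tammes_thirteen) (hX1 : ∀ y ∈ X, ‖y‖ = 1) (hcard : X.card = 12)
  (hsepX : ∀ u ∈ X, ∀ u' ∈ X, u ≠ u' → ⟪u, u'⟫ ≤ 1 - 1 / (2 * (101 / 100 : ℝ) ^ 2))
  (hB : ∀ T ∈ B, ∃ u ∈ X, ∃ u' ∈ X, u ≠ u' ∧ 1 - (101 / 100 : ℝ) ^ 2 / 2 ≤ ⟪u, u'⟫ ∧ T = {u, u'})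
  (hBcard : B.card = 24)
  (hdeg : ∀ v ∈ X, ∃ w : Fin 4 → EuclideanSpace ℝ (Fin 3), (∀ k, w k ∈ X) ∧
    Function.Injective w ∧ (∀ k, w k ≠ v) ∧
    (∀ k, ({v, w k} : Finset (EuclideanSpace ℝ (Fin 3))) ∈ B) ∧
    ∀ y, ({v, y} : Finset (EuclideanSpace ℝ (Fin 3))) ∈ B → ∃ k, y = w k)


include hT hX1 hcard hsepX hB hBcard hdeg in
open scoped Classical in
/-- **The facets at zero slack**: triangles with at most one non-bond side, and quadrilaterals
with none. -/
theorem facet_kinds_of_no_slack :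
    ∀ c ∈ facetNormals X,
      ((tightSet X c).card = 3 ∧ ((edgesOfFacet X c).filter (fun T => T ∉ B)).card ≤ 1) ∨
      ((tightSet X c).card = 4 ∧ ((edgesOfFacet X c).filter (fun T => T ∉ B)).card = 0) := by
  obtain ⟨-, -, hnb, hnb2, -⟩ := tight_counts_one_percent hT hX1 hcard hsepX hB hBcard hdeg
  obtain ⟨-, ht2⟩ := no_slack_one_percent hT hX1 hcard hsepX hB hBcard hdeg
  obtain ⟨-, -, -, -, -, h34, -, -⟩ := hull_counts_of_twelve hT hX1 hcard hsepX hB hBcard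
  intro c hc
  rcases h34 c hc with h3 | h4
  · left
    refine ⟨h3, ?_⟩
    have hle := (hnb c hc).1 h3
    -- `nb = 2` would put the vertices of `c` in `V₃`, which is empty
    rcases Nat.lt_or_ge (((edgesOfFacet X c).filter (fun T => T ∉ B)).card) 2 with hlt | hge
    · omega
    · exfalso
      have h2 : ((edgesOfFacet X c).filter (fun T => T ∉ B)).card = 2 := by omega
      obtain ⟨u, hu⟩ : (tightSet X c).Nonempty := Finset.card_pos.1 (by omega)
      have h3u := hnb2 c hc h3 h2 u hu
      have huX : u ∈ X := tightSet_subset X c hu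
      have := ht2 u huX
      omega
  · right
    exact ⟨h4, (hnb c hc).2 h4⟩

end Setting

end Summit.AtomisticToContinuum.Crystallization.Theorems
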